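import Summits.QuantumFields.BalabanUV.T4Continuum.Spine.NE1p.DressedSmallFieldInnerCount

/-!
# T⁴ programme, spine estimate NE1′ (node O3b/H2) — THE THIRD AND FOURTH RESUMMATION STEPS OF (B3)'s COUNT, TABLE-BLIND: for a
# polymer `Z` of the step geometry the count over the outer labels `(Z∖Z′₀, {Z′_i}, inner data)` — uncovered cubes `W′`, a covering
# family of `G.cubes Z ∖ W′` by scale-`(k+1)` domains, one inner datum per member — of the majorant `v^{#W′}·Π_{Z′∈F} n Z′(p Z′)`
# is `≤ e^{c₁u−5R}·e^{−(R−c₁u)d(Z)}` (`u := v·e^{Rc′}`): (2.29) AT SCALE k+1 on `G` by b13's `ineq229_locDomainSys`, (2.27) = `G.ineq227`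
# KIND, the subset sum by b13's `sum_powerset_le_exp_234` — [Balaban1988RGII] (2.35)–(2.37), (2.39) KIND; END on N0s's count socket

Cell `pub-balaban`, sub-cell `t4`, BINDER-OWNERS row NE1′; owner lineage t4-ne1p-p1 (PROVER seat P1, «RG-trajectory comparison …
μ-uniformity through the printed small-field bounds»), generation 29; ADDITIVE — imports the owner's N0u
`Spine/NE1p/DressedSmallFieldInnerCount` ONLY (→ N0t → N0s → N0r → …; b13's `B13.lean` ∕ `B13FamilySum` in the cone); THEOREMS ONLY
(0 def, 0 `def … : Prop`, 0 cite); nothing of N0s ∕ N0u ∕ b13's modules is restated — used BY NAME.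

WHY THIS FILE.  N0s (the 𝐃-sum at fixed Y₀) and N0u (the Y₀∕P-sum at fixed Z₀) put the first two of print's four resummation steps
(p. 17) in kernel on the cell's format, table-blind.  The last two are of the same kind, p. 19–20: «The next step is to bound the sum
over Z₀, with Z′₀ fixed. Again the set Z′₀ is a union of connected components, which are localization domains from 𝐃_{k+1}, and we
denote by Z′₀ one of the components. The set Z₀ determining it is a union of connected components, Z₀ = ∪Z_i, and we denote by Z′_i
the smallest localization domain from 𝐃_{k+1} containing Z̃_i. … For each Z′_i we sum over all possible components of Z₀ determining
this Z′_i. The we sum over all families of domains Z′_i such, that ∪Z′_i = Z′₀. … A sum over n components is estimated by a product of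
n sums, each of them is a sum over independently changing components. The last sum is estimated using (1.28)», (2.36); p. 20: «Finally,
the sum over all families of different localization domains Z′_i from 𝐃_{k+1}, satisfying the condition ∪Z′_i = Z′₀, is estimated
using (2.29). We have δ½Lκd_{k+1}(Z′_i) instead of δκd_k(Y), but the inequality (2.29) is valid for all k. The inequality (2.27) is
used for the remaining exponential factors.» (2.37); «The last sum to estimate is the sum over Z′₀, or over Z∖Z′₀. Using the inequality
(2.32), properly adapted to the new situation, we bound the exponential factors in the square bracket above, and half of the first
exponential factor, by exp(−(1−7δ)½Lκd_{k+1}(Z)). … The sum over Z∖Z′₀ is bounded, using the remaining factor and an inequality similar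
to (2.34), by exp(exp(−½(κ₁−1))(LM)⁻⁴|Z|).»  On the cell's format (a covering family of `G.cubes Z ∖ W′` BY scale-`(k+1)` domains `Z′_i`
plays «∪Z′_i = Z′₀», the inner datum of a member plays «the components of Z₀ determining this Z′_i» with N0u's inner labels inside):
* §1 `fibredCount_le` (kernel; the FOURTH step, (2.35)∕(2.39) KIND): labels `⟨W′, i⟩`, `W′ ⊆ C`, `i ∈ I W′`, weights `v^{#W′}·m W′ i`;
  fibrewise inner bounds `≤ e^{−R(dZ − c′#W′ + 5)}` ⇒ total `≤ e^{−R(dZ+5)}·e^{#C·u}`, `u := v·e^{Rc′}` — `Finset.sum_sigma` + b13's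
  `sum_powerset_le_exp_234` BY NAME.
* §2 `familyPi_count_le` (kernel; the THIRD step, «a product of n sums»): labels `⟨F, p⟩`, `F ∈ coveringFamilies S cubes Y₀`, `p ∈ F.pi J`,
  weights `Π_{Z′∈F} n Z′ (p Z′)`; `Finset.prod_sum` turns the sum over choices into `Π_{Z′∈F} Σ_{j∈J Z′} n Z′ j`, the per-member bound
  `hmember : Σ_j n Z′ j ≤ a·e^{−r d Z′}·e^{−R(d Z′ + c)}` and N0s's `count_coveringFamilies` ((2.27) link + (2.29)) give `≤ e^{−R(dZ₀+c)}`.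
* §3 END **`attachedPart_locE_le_of_coresAt_pencil_outerLabels`** — N0s's `attachedPart_locE_le_of_coresAt_pencil_count` ONCE BY NAME at the
  index `Σ _ : Finset Cube, Σ F : Finset D.Dom, ∀ Z′ ∈ F, κ Z′`, `hCount` SUPPLIED by §1 ∘ §2 ON THE STEP GEOMETRY `G` ITSELF ((2.29) at
  scale `k+1` by `ineq229_locDomainSys` with `G.κ₀ + 1 ≤ r`, `e·G.K₀·G.c₁·a ≤ 1`; `G.volBound Z`; rate bookkeeping `Rkp ≤ R − c₁u`
  — whence `0 ≤ R` and `c₁u ≤ 5R`, derived); displayed of (B3): `hadm` (terms of `Z` = outer labels — (B1b) READING), the per-label AMPLITUDE `hAmp`, the per-member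
  inner bound `hmember` (= WHERE N0u's inner count, the (2.36) transfer and the anchored (1.28)-KIND component sum enter — NOT composed
  here), the (2.27)∘(2.37)-KIND link `hlink` (at `W′ = ∅` literally `G.ineq227 Z`), the clauses.  NO `foot`∕`hmono`: this END lives at
  scale `k+1`.

WHAT THIS DOES TO THE WALL (owner's reading; nothing re-labelled; joins Q47).  With N0s∕N0u∕this file, (B3-count) = ALL FOUR of print's
resummation steps as TABLE-BLIND kernel counts on the cell's format, μ-FREE by construction, each fed BY NAME from b13's PROVED (2.29) ∕
(2.34)-type lemmas and the (2.11)-geometries' (1.26)∕(2.27)∕volume fields; what stays DISPLAYED of printed KIND are the LINKS ((2.27) off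
the diagonal, (2.32), (2.36)∕(2.37): `hlink`∕`hmono`∕`hmember`'s rate) and the (1.28)-KIND anchored component sum inside `hmember`;
(B3-form)∕(B3-arith) as N0t.  NOTHING of (B3) is discharged on Bałaban's densities; all label identifications are (B1b) READING; 0
binders instantiated on Bałaban's (2.14) data; wall v1.7 does NOT move; NE1′ NOT printed, NOT proved; 0∕9; count 9 unchanged.

HONEST FRAMING.  Finite combinatorics + real arithmetic and one by-name application of N0s's END; the quotations above are LOCI of the
audited manuscript [Balaban1988RGII] = CMP 116 (1988) 1–22 (renders `…-p017∕p019∕p020-x2.png` read as images this generation), TYPE∕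
CONTEXT only, never hypothesis-free facts; ABSOLUTE RULE honoured; nothing internally minted is cited.  Rung (B)+1 on ONE finite T⁴ — NOT
infinite volume, NOT a mass gap, NOT OS on ℝ⁴, NOT Clay.  HONEST DEPENDENCY: continuum YM on T⁴ ⇐ BetaPertH ∧ nine spine estimates (0/9
proved); BetaPertH ⇐ (D1) ∧ (D4) ∧ CAP+tail; G-an2-4 gates asym, D1 and NE2/3/4. -/
noncomputable section

namespace Summit.QuantumFields.BalabanUV.T4Continuum.NE1p.DressedSmallFieldOuterCount

open Metric Set Complex MeasureTheory
open scoped BigOperators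
open Literature.MathematicalPhysics.QuantumFieldTheory.Balaban1983to89 (LocDomainSys)
open Literature.MathematicalPhysics.QuantumFieldTheory.Balaban1983to89.B13 (sum_powerset_le_exp_234)
open Literature.MathematicalPhysics.QuantumFieldTheory.Balaban1983to89.B13FamilySum (coveringFamilies Ineq229 mem_coveringFamilies
  ineq229_locDomainSys)
open Literature.MathematicalPhysics.QuantumFieldTheory.Balaban1983to89.T4OutputRate (Carriers)
open Literature.MathematicalPhysics.QuantumFieldTheory.Balaban1983to89.B13Resummation (locE Geometry)
open Summit.QuantumFields.BalabanUV.T4Continuum.B13HistMeasurable (MeasPotFrame B13HistM)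
open Summit.QuantumFields.BalabanUV.T4Continuum.B13TermParamGaussianBi (BiCore)
open Summit.QuantumFields.BalabanUV.T4Continuum.NE1p.DressedSmallFieldFamilyCount (count_coveringFamilies c₁_pos_of_geometry
  attachedPart_locE_le_of_coresAt_pencil_count)

/-! ## §1 THE GENERIC FIBRED COUNT: uncovered cubes `W′ ⊆ C` × an inner sum bounded fibrewise -/

section Fibred

variable {Cube ι : Type*} [DecidableEq Cube]

/-- **THE FIBRED SUBSET COUNT** (kernel; (2.34)∕(2.37)∕(2.39) KIND): over labels `⟨W′, i⟩` with `W′ ⊆ C` and `i` in a finite fibre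
`I W′`, weights `v^{#W′}·m W′ i` (`0 ≤ v`, `0 ≤ m`); if every fibre's inner sum is `≤ e^{−R(dZ − c′·#W′ + 5)}` (the LINK: the covered
part carries the tree length up to `c′` per uncovered cube) then for ANY sub-collection of labels the total is
`≤ e^{−R(dZ+5)}·e^{#C·(v·e^{Rc′})}` — b13's `sum_powerset_le_exp_234` BY NAME for the subset sum. [folklore] -/
theorem fibredCount_le (C : Finset Cube) (I : Finset Cube → Finset ι) (m : Finset Cube → ι → ℝ) {v R c' dZ : ℝ}
    (hv : 0 ≤ v) (hm : ∀ W i, 0 ≤ m W i)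
    (hfib : ∀ W ⊆ C, ∑ i ∈ I W, m W i ≤ Real.exp (-(R * (dZ - c' * W.card + 5))))
    {terms : Finset (Σ _ : Finset Cube, ι)} (hadm : ∀ l ∈ terms, l.1 ⊆ C ∧ l.2 ∈ I l.1) :
    ∑ l ∈ terms, v ^ l.1.card * m l.1 l.2 ≤
      Real.exp (-(R * (dZ + 5))) * Real.exp ((C.card : ℝ) * (v * Real.exp (R * c'))) := by
  classical
  set u := v * Real.exp (R * c') with hu
  have hu0 : 0 ≤ u := by positivity
  set adm : Finset (Σ _ : Finset Cube, ι) := C.powerset.sigma I with hadm_def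
  have hsub : terms ⊆ adm := fun l hl =>
    Finset.mem_sigma.2 ⟨Finset.mem_powerset.2 (hadm l hl).1, (hadm l hl).2⟩
  calc ∑ l ∈ terms, v ^ l.1.card * m l.1 l.2
      ≤ ∑ l ∈ adm, v ^ l.1.card * m l.1 l.2 :=
        Finset.sum_le_sum_of_subset_of_nonneg hsub fun l _ _ => mul_nonneg (pow_nonneg hv _) (hm _ _)
    _ = ∑ W ∈ C.powerset, ∑ i ∈ I W, v ^ W.card * m W i := Finset.sum_sigma _ _ _
    _ = ∑ W ∈ C.powerset, v ^ W.card * ∑ i ∈ I W, m W i := by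
        refine Finset.sum_congr rfl fun W _ => ?_; rw [Finset.mul_sum]
    _ ≤ ∑ W ∈ C.powerset, v ^ W.card * Real.exp (-(R * (dZ - c' * W.card + 5))) :=
        Finset.sum_le_sum fun W hW => mul_le_mul_of_nonneg_left (hfib W (Finset.mem_powerset.1 hW)) (pow_nonneg hv _)
    _ = ∑ W ∈ C.powerset, Real.exp (-(R * (dZ + 5))) * u ^ W.card := by
        refine Finset.sum_congr rfl fun W _ => ?_
        rw [hu, mul_pow, ← Real.exp_nat_mul, show -(R * (dZ - c' * W.card + 5)) =
          -(R * (dZ + 5)) + (W.card : ℝ) * (R * c') by ring, Real.exp_add]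
        ring
    _ = Real.exp (-(R * (dZ + 5))) * ∑ W ∈ C.powerset, u ^ W.card := by rw [Finset.mul_sum]
    _ ≤ Real.exp (-(R * (dZ + 5))) * Real.exp ((C.card : ℝ) * u) :=
        mul_le_mul_of_nonneg_left (sum_powerset_le_exp_234 C u hu0) (Real.exp_pos _).le

end Fibred

/-! ## §2 THE FAMILY × INNER-DATA COUNT: covering families `{Z′_i}` with a dependent choice of inner data per member -/

section FamilyPi

variable {Dom Cube : Type*} [DecidableEq Cube] [DecidableEq Dom] {κ : Dom → Type*}

/-- **COVERING FAMILIES WITH INNER DATA** (kernel; (2.35)∕(2.39) KIND: «A sum over n components is estimated by a product of n sums,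
each of them is a sum over independently changing components», p. 19): labels `⟨F, p⟩` — `F` a covering family of `Y₀` from the
catalogue `S`, `p` a choice of inner datum `p Z ∈ J Z` for every member — with weights `Π_{Z∈F} n Z (p Z)` (`n ≥ 0`); if every
member's inner sum is `≤ a·e^{−r d Z}·e^{−R(d Z + c)}` (`hmember`), (2.29) holds for the amplitude `a` and (2.27) links `dZ₀` to the
family, then ANY sub-collection sums to `≤ e^{−R(dZ₀ + c)}` — `Finset.prod_sum` + N0s's `count_coveringFamilies` BY NAME. [folklore] -/
theorem familyPi_count_le (S : Finset Dom) (cubes : Dom → Finset Cube) (d : Dom → ℝ) (Y₀ : Finset Cube)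
    (J : ∀ Z, Finset (κ Z)) (n : ∀ Z, κ Z → ℝ) (hn : ∀ Z j, 0 ≤ n Z j) {a r R c dZ₀ : ℝ} (ha : 0 ≤ a) (hR : 0 ≤ R)
    (hmember : ∀ Z ∈ S, ∑ j ∈ J Z, n Z j ≤ a * Real.exp (-(r * d Z)) * Real.exp (-(R * (d Z + c))))
    (h229 : ∑ F ∈ coveringFamilies S cubes Y₀, ∏ Z ∈ F, a * Real.exp (-(r * d Z)) ≤ 1)
    (h227 : ∀ F ∈ coveringFamilies S cubes Y₀, dZ₀ + c ≤ ∑ Z ∈ F, (d Z + c))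
    {terms : Finset (Σ F : Finset Dom, ∀ Z ∈ F, κ Z)}
    (hadm : ∀ l ∈ terms, l.1 ∈ coveringFamilies S cubes Y₀ ∧ l.2 ∈ l.1.pi J) :
    ∑ l ∈ terms, ∏ x ∈ l.1.attach, n x.1 (l.2 x.1 x.2) ≤ Real.exp (-(R * (dZ₀ + c))) := by
  classical
  set adm : Finset (Σ F : Finset Dom, ∀ Z ∈ F, κ Z) := (coveringFamilies S cubes Y₀).sigma fun F => F.pi J with hadm_def
  have hsub : terms ⊆ adm := fun l hl => Finset.mem_sigma.2 ⟨(hadm l hl).1, (hadm l hl).2⟩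
  have h0 : ∀ l : (Σ F : Finset Dom, ∀ Z ∈ F, κ Z), 0 ≤ ∏ x ∈ l.1.attach, n x.1 (l.2 x.1 x.2) :=
    fun l => Finset.prod_nonneg fun x _ => hn _ _
  calc ∑ l ∈ terms, ∏ x ∈ l.1.attach, n x.1 (l.2 x.1 x.2)
      ≤ ∑ l ∈ adm, ∏ x ∈ l.1.attach, n x.1 (l.2 x.1 x.2) := Finset.sum_le_sum_of_subset_of_nonneg hsub fun l _ _ => h0 l
    _ = ∑ F ∈ coveringFamilies S cubes Y₀, ∑ p ∈ F.pi J, ∏ x ∈ F.attach, n x.1 (p x.1 x.2) := Finset.sum_sigma _ _ _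
    _ = ∑ F ∈ coveringFamilies S cubes Y₀, ∏ Z ∈ F, ∑ j ∈ J Z, n Z j := by
        refine Finset.sum_congr rfl fun F _ => ?_; rw [Finset.prod_sum]
    _ ≤ ∑ F ∈ coveringFamilies S cubes Y₀, ∏ Z ∈ F, (a * Real.exp (-(r * d Z)) * Real.exp (-(R * (d Z + c)))) := by
        refine Finset.sum_le_sum fun F hF => Finset.prod_le_prod (fun Z _ => Finset.sum_nonneg fun j _ => hn Z j) fun Z hZ => ?_
        exact hmember Z ((mem_coveringFamilies.1 hF).1 hZ)
    _ ≤ Real.exp (-(R * (dZ₀ + c))) := count_coveringFamilies S cubes d Y₀ ha hR h229 h227 subset_rfl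

end FamilyPi

/-! ## §3 THE END: cores indexed by OUTER LABELS `(Z∖Z′₀, {Z′_i}, inner data)`, steps three and four DISCHARGED by §1–§2 -/

section End

variable {C : Carriers} {P : MeasPotFrame C} {Op : Type*} [NormedAddCommGroup Op] [NormedSpace ℂ Op]
variable (D : LocDomainSys) {Cube : Type} [DecidableEq Cube] (G : Geometry D Cube) {κ : D.Dom → Type}
  {𝒴 : ℕ → (Σ _ : Finset Cube, Σ F : Finset D.Dom, ∀ Z ∈ F, κ Z) → Type*} {dom : ∀ k i, 𝒴 k i → C.Dom}
  {β : ℕ → (Σ _ : Finset Cube, Σ F : Finset D.Dom, ∀ Z ∈ F, κ Z) → Type*} [∀ k i, MeasurableSpace (β k i)]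
  {α : ℕ → (Σ _ : Finset Cube, Σ F : Finset D.Dom, ∀ Z ∈ F, κ Z) → Type*} [∀ k i, NormedAddCommGroup (α k i)]
  [∀ k i, InnerProductSpace ℝ (α k i)] [∀ k i, FiniteDimensional ℝ (α k i)] [∀ k i, MeasurableSpace (α k i)]
  [∀ k i, BorelSpace (α k i)]

open Classical in
/-- **THE ATTACHED PART FOR CORES INDEXED BY OUTER LABELS, RESUMMATION STEPS THREE AND FOUR DISCHARGED** (kernel; N0s's
`attachedPart_locE_le_of_coresAt_pencil_count` ONCE BY NAME at the index `⟨W′, ⟨F, p⟩⟩` — `W′ ⊆ G.cubes Z` the cubes of `Z∖Z′₀`,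
`F` a covering family of `G.cubes Z ∖ W′` by scale-`(k+1)` domains (print's `Z′_i`, (2.35)–(2.37)), `p` a choice of inner datum
`p Z′ ∈ J Z′` per member (stated member-wise, no `Finset.pi` instance in the binder) (print's components `Z_i` with their inner labels — N0u's currency) — with the table-blind majorant
`v^{#W′}·Π_{Z′∈F} n Z′ (p Z′)` and `hCount` SUPPLIED by §1 ∘ §2: (2.29) AT SCALE `k+1` BY NAME from b13's `ineq229_locDomainSys` on
the step geometry `G` itself (`G.κ₀ + 1 ≤ r`, `e·G.K₀·G.c₁·a ≤ 1`), the volume bound `G.volBound Z`, the displayed per-member inner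
bound `hmember` (Σ_j n Z′ j ≤ a·e^{−r d(Z′)}·e^{−R(d(Z′)+5)} — WHERE N0u's inner count, the (2.36) transfer and the anchored component
sum (1.28) KIND enter), the displayed (2.27)∘(2.37)-KIND link `hlink` (at `W′ = ∅` it is `G.ineq227 Z` exactly) and the rate
bookkeeping `Rkp ≤ R − c₁u` (`u := v·e^{Rc′}`; print: `v = e^{−(κ₁−1)}` per uncovered cube, (2.35); `0 ≤ R`, `c₁u ≤ 5R` derived).  Conclusion as N0s's. -/
theorem attachedPart_locE_le_of_coresAt_pencil_outerLabels {Win : Set (ℕ → ℝ)}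
    {ctr : ℕ → (ℕ → ℝ) → C.BgB → Op × B13HistM P} {ROp RHist R' : ℕ → ℝ}
    (𝔊 : ∀ k i, C.Dom → BiCore P (dom k i) Op (β k i) (α k i))
    {mq bq N₀ : ℕ → (Σ _ : Finset Cube, Σ F : Finset D.Dom, ∀ Z ∈ F, κ Z) → C.Dom → ℝ}
    (hroom : ∀ k, ROp k < R' k)
    (hm : ∀ k, ∀ g ∈ Win, ∀ (U : C.BgB) (X : C.Dom), C.scale X = k → ∀ i, 0 < mq k i X)
    (hN : ∀ k, ∀ g ∈ Win, ∀ (U : C.BgB) (X : C.Dom), C.scale X = k → ∀ i,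
      (∀ o ∈ ball (ctr k g U).1 (R' k), AEStronglyMeasurable ((𝔊 k i X).N o) (𝔊 k i X).lam) ∧
      (∀ p, DifferentiableOn ℂ (fun o => (𝔊 k i X).N o p) (ball (ctr k g U).1 (R' k))) ∧
      (∀ o ∈ ball (ctr k g U).1 (R' k), ∀ p, ‖(𝔊 k i X).N o p‖ ≤ N₀ k i X))
    (hq : ∀ k, ∀ g ∈ Win, ∀ (U : C.BgB) (X : C.Dom), C.scale X = k → ∀ i,
      (∀ o ∈ ball (ctr k g U).1 (R' k),
        AEStronglyMeasurable (Function.uncurry ((𝔊 k i X).q o)) ((𝔊 k i X).lam.prod volume)) ∧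
      (∀ p v, DifferentiableOn ℂ (fun o => (𝔊 k i X).q o p v) (ball (ctr k g U).1 (R' k))) ∧
      (∀ o ∈ ball (ctr k g U).1 (R' k), ∀ p v, mq k i X * ‖v‖ ^ 2 - bq k i X ≤ ((𝔊 k i X).q o p v).re))
    {k : ℕ} {g : ℕ → ℝ} (hg : g ∈ Win) {U : C.BgB} {o : Op} {h₀ w : B13HistM P} {ϱ : ℝ}
    (hO : ‖o - (ctr k g U).1‖ ≤ ROp k) (hH : ‖h₀ - (ctr k g U).2‖ + ϱ * ‖w‖ ≤ RHist k)
    {emb : D.Dom → C.Dom} (hscale : ∀ Z, C.scale (emb Z) = k)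
    {terms : D.Dom → Finset (Σ _ : Finset Cube, Σ F : Finset D.Dom, ∀ Z ∈ F, κ Z)} {act : ℂ → D.Dom → ℂ}
    (hact : ∀ σ ∈ ball (0 : ℂ) ϱ, ∀ Z, act σ Z = ∑ i ∈ terms Z, (𝔊 k i (emb Z)).termAt o (h₀ + σ • w))
    {A₀ A₁ Rkp r₁ b₅ : ℝ} {X₀ : D.Dom} (hA₀ : 0 ≤ A₀) (hA₁ : 0 ≤ A₁) (hr₁ : 0 ≤ r₁) (hb : r₁ * 5 ≤ b₅)
    (hrate : r₁ + 2 * G.κ₀ + 2 ≤ Rkp) (hsmall : (A₀ + ϱ * A₁) * Real.exp (b₅ + 1) * G.K₀ * G.ν * G.c₁ ≤ 1)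
    (J : ∀ Z : D.Dom, Finset (κ Z)) (n : ∀ Z : D.Dom, κ Z → ℝ) (hn : ∀ Z j, 0 ≤ n Z j)
    {a r R c' v : ℝ} (ha : 0 ≤ a) (hv : 0 ≤ v)
    (hκ : G.κ₀ + 1 ≤ r) (h229 : Real.exp 1 * G.K₀ * G.c₁ * a ≤ 1)
    (hmember : ∀ Z', ∑ j ∈ J Z', n Z' j ≤ a * Real.exp (-(r * D.dj Z')) * Real.exp (-(R * (D.dj Z' + 5))))
    (hlink : ∀ Z, ∀ W ⊆ G.cubes Z, ∀ F ∈ coveringFamilies Finset.univ G.cubes (G.cubes Z \ W),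
      D.dj Z - c' * W.card + 5 ≤ ∑ Z' ∈ F, (D.dj Z' + 5))
    (hRR : Rkp ≤ R - G.c₁ * (v * Real.exp (R * c')))
    (hadm : ∀ Z, ∀ l ∈ terms Z, l.1 ⊆ G.cubes Z ∧
      l.2.1 ∈ coveringFamilies Finset.univ G.cubes (G.cubes Z \ l.1) ∧ ∀ Z' (h : Z' ∈ l.2.1), l.2.2 Z' h ∈ J Z')
    (hAmp : ∀ Z, G.cubes Z ⊆ G.cubes X₀ → ∀ l ∈ terms Z,
      (𝔊 k l (emb Z)).lam.real univ * ((𝔊 k l (emb Z)).wB * N₀ k l (emb Z) * Real.exp (bq k l (emb Z))) *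
          (Real.pi / (mq k l (emb Z) / 2)) ^ (Module.finrank ℝ (α k l) / 2 : ℝ) *
        Real.exp ((𝔊 k l (emb Z)).N₁ * (‖h₀‖ + ϱ * ‖w‖)) ≤
      (A₀ + ϱ * A₁) * (v ^ l.1.card * ∏ x ∈ l.2.1.attach, n x.1 (l.2.2 x.1 x.2)))
    (hϱ : 2 ≤ ϱ) (hϱA : A₀ ≤ ϱ * A₁) :
    ‖locE G.ι G.cubes (act 1) (G.cubes X₀) - locE G.ι G.cubes (act 0) (G.cubes X₀)‖ ≤
      4 * (Real.exp 1 * G.ν * G.c₁ * G.K₀ ^ 2) * A₁ * Real.exp (-(r₁ * D.dj X₀)) := by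
  -- the table-blind count, polymer by polymer (steps three and four), then N0s's count END ONCE BY NAME
  have hc₁ : 0 < G.c₁ := c₁_pos_of_geometry G X₀
  -- rate bookkeeping: `0 ≤ R` and `c₁u ≤ 5R` FOLLOW from `hrate` ∕ `hRR` (as in N0u, crew X152 (I1))
  have hcu : 0 ≤ G.c₁ * (v * Real.exp (R * c')) := mul_nonneg hc₁.le (by positivity)
  have hR : 0 ≤ R := by linarith [G.κ₀_nonneg]
  have h229' : Ineq229 (Finset.univ : Finset D.Dom) G.cubes D.dj a (1 * r) :=
    ineq229_locDomainSys D G.cubes G.κ₀ G.K₀ G.c₁ 1 r a 1 G.cubes_nonempty G.volBound G.ineq126 ha zero_le_one hc₁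
      (by linarith) (by linarith)
  have h229r : ∀ Y₀ : Finset Cube,
      ∑ F ∈ coveringFamilies Finset.univ G.cubes Y₀, ∏ Z' ∈ F, a * Real.exp (-(r * D.dj Z')) ≤ 1 := fun Y₀ => by
    have h := h229' Y₀; rw [one_mul] at h; exact h
  have hCount : ∀ Z : D.Dom, ∑ l ∈ terms Z, v ^ l.1.card * ∏ x ∈ l.2.1.attach, n x.1 (l.2.2 x.1 x.2) ≤
      Real.exp (-(Rkp * D.dj Z)) := by
    intro Z
    have hfib : ∀ W ⊆ G.cubes Z,
        ∑ i ∈ (coveringFamilies Finset.univ G.cubes (G.cubes Z \ W)).sigma (fun F => F.pi J),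
          (∏ x ∈ i.1.attach, n x.1 (i.2 x.1 x.2)) ≤ Real.exp (-(R * (D.dj Z - c' * W.card + 5))) :=
      fun W hW => familyPi_count_le Finset.univ G.cubes D.dj (G.cubes Z \ W) J n hn ha hR (fun Z' _ => hmember Z')
        (h229r _) (hlink Z W hW) fun l hl => Finset.mem_sigma.1 hl
    have hcount := fibredCount_le (G.cubes Z)
      (fun W => (coveringFamilies Finset.univ G.cubes (G.cubes Z \ W)).sigma fun F => F.pi J)
      (fun _ i => ∏ x ∈ i.1.attach, n x.1 (i.2 x.1 x.2)) hv (fun _ i => Finset.prod_nonneg fun x _ => hn _ _) hfib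
      (terms := terms Z) fun l hl => ⟨(hadm Z l hl).1, Finset.mem_sigma.2 ⟨(hadm Z l hl).2.1, Finset.mem_pi.2 (hadm Z l hl).2.2⟩⟩
    refine hcount.trans ?_
    have hvol := G.volBound Z (Finset.mem_univ Z)
    have hu0 : 0 ≤ v * Real.exp (R * c') := by positivity
    rw [← Real.exp_add]
    refine Real.exp_le_exp.2 ?_
    have hd : 0 ≤ D.dj Z := D.dj_nonneg Z
    have hRkp : 0 ≤ Rkp := by linarith [G.κ₀_nonneg]
    have h2 : Rkp * D.dj Z ≤ (R - G.c₁ * (v * Real.exp (R * c'))) * D.dj Z := mul_le_mul_of_nonneg_right hRR hd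
    have h3 : ((G.cubes Z).card : ℝ) * (v * Real.exp (R * c')) ≤ G.c₁ * (1 + D.dj Z) * (v * Real.exp (R * c')) :=
      mul_le_mul_of_nonneg_right hvol hu0
    have h4 : G.c₁ * (v * Real.exp (R * c')) ≤ 5 * R := by linarith [G.κ₀_nonneg]
    nlinarith
  exact attachedPart_locE_le_of_coresAt_pencil_count D G 𝔊 hroom hm hN hq hg hO hH hscale hact hA₀ hA₁ hr₁ hb hrate hsmall
    (fun _ l => v ^ l.1.card * ∏ x ∈ l.2.1.attach, n x.1 (l.2.2 x.1 x.2)) hAmp (fun Z _ => hCount Z) hϱ hϱA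

end End

end Summit.QuantumFields.BalabanUV.T4Continuum.NE1p.DressedSmallFieldOuterCount

end
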